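/-
Copyright (c) 2026 the pub-hodgecm-mathlib formalisation cell (harness21).  Prover seat hodgecm-mathlib-F0P2-p02 (g13): road «S3-ram» (LEAD F0P3a-plan (g12); architect
A-p16 (g31); owner F0P3a-p06 (g15)), junction row ROW-ROOT-CNT of F0P3a-p01 (g17)'s J-PACK v2 (03ef5f1f §2); 2026-09-02.
-/
import Literature.GroupTheory.SpecificGroups.OrthogonalThreeIsotropicParamsClassCount                -- ★ G3‴ (F0P2-p06 (g13)): `card_sub_one_mul_natCard_params_eq_ncard` (params ↔ vectors); brings ★ G3″ (`…nullParams…`)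
import Literature.NumberTheory.Rogawski1990.DepthZeroKappaTransferTypeOneRamifiedRootClassSplit         -- ★ (F0P3a-p02 (g16)): `card_isoNull_eq`, `two_mul_card_rootClass_eq`; brings ★ RootTwists `card_rootNull`
import HarnessLib

/-!
# The ramified type-(1) `κ`-orbital integral: ROOT LINE COUNTS — the `J₀`-side parameter counts of the junction are the `D`-side chart ∕ vector counts of ★ RootTwists ∕ RootClassSplit
# (Rogawski 1990 §4.9; Bruhat–Tits 1972 §10; Ireland–Rosen Ch. 8)

Topic `NumberTheory/Rogawski1990`; namespace `Literature.NumberTheory.Rogawski1990`.  THEOREMS ONLY (no definition, no instance, no notation, no named fact, no `sorry`); kernel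
lane `--supports stmt-HodgeConjecture-24833`; finite-field algebra over an arbitrary field `k` (finite where counted).  Cell `pub/hodgecm-mathlib` (D-0151), crux H413; road «S3-ram»
(count-neutral), P-1-ram organ A′ (ii) (a2); junction row **ROW-ROOT-CNT** of the J-PACK v2 deal sheet (F0P3a-p01 (g17), `F0/P3a/F0P3a-p01/g17/junction/JPACK-v2…md` §2).
Seat F0P2-p02 (g13).  HONEST LABEL: HC_CM is proved only modulo the 2 remaining named inputs (hLiu418 24832, h413 24833) until rung 0 closes; nothing printed is asserted here.

THE MATHEMATICS.  The junction runs the tree-induction engine in the `J₀`-MODEL (`J₀ = antidiag(1,1,1)`); at the root `L₀` the labels of the `q(q+1)` grandchildren are read on the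
`q + 1` isotropic LINES of the residual conic `ᵗx̄J₀x̄ = 0` through a residual predicate `P(ᵗx̄(J₀Ȳ)x̄)` on the leading matrix `Ȳ` (★ G3⁗ `ncard_neighborSet_root_pred_eq_natCard`
counts them as `Nat.card {p : params // P(ᵗx̄_p(J₀Ȳ)x̄_p)}`, params = the normalised isotropic vectors `x̄_∞ = e₂`, `x̄_(a,b) = (1, a, b)`, `2b + a² = 0`; ★ G3″∕G3‴
`card_sub_one_mul_natCard_{null,}params_eq_ncard` multiply by `q − 1` to reach the VECTOR currency).  The literal's data live in the DIAGONAL model: residual form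
`diag(δ)` and residual eigenvalue-difference matrix `diag(s)` (`s = (A, 0, C)` after the `u`-normalisation), related to the `J₀`-model by the residue `B` of the ★ frame
(`ᵗB J₀ B = c·diag(δ)`, `c ≠ 0`; `Ȳ = B·diag(s)·B⁻¹`).  §1 transports every predicate-cut isotropic VECTOR count along `y ↦ By`
(`ᵗ(By)J₀(By) = c·Σδᵢyᵢ²`, `ᵗ(By)(J₀Ȳ)(By) = c·Σδᵢsᵢyᵢ²`); §2 is the coordinate dictionary `(Fin 3 → k) ↔ k × k × k` to the filters of ★ RootTwists ∕ RootClassSplit; §3 gives the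
NULL count **`Nat.card {p // ᵗx̄_p(J₀Ȳ)x̄_p = 0} = #{(a,b) : δ₀ + δ₁a² + δ₂b² = 0 ∧ δ₀s₀ + δ₂s₂b² = 0}`** (= ★ `card_rootNull`'s set: `(χ(δ₀δ₁C(A−C))+1)(χ(−δ₀δ₂AC)+1)` null lines, `q`
grandchildren of label `E` each — the engine's `NE ∕ q`), §4 the CLASS counts in ★ RootClassSplit's vector currency
(`(q−1)·Nat.card {p // χ(c₀·ᵗx̄_p(J₀Ȳ)x̄_p) = σ} = #{v ∈ k³ : iso_δ(v) ∧ χ((c₀c)·Q(v)) = σ}` — the engine's `NP ∕ NM` through ★ `two_mul_card_rootClass_eq`).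
* §1 `dotProduct_frame_mulVec`, `dotProduct_frame_conj_mulVec`, `mulVec_injective_of_GL`, **`image_frame_isotropic_pred_eq`**, **`ncard_isotropic_pred_eq_of_frame`**.
* §2 `dotProduct_diagonal_mulVec_three`, `ncard_setOf_fin_three_eq_card_filter`, `ncard_setOf_ne_zero_and_eq_ncard_sub_one`.
* §3 **`natCard_nullParams_conj_frame_eq_card_filter`** (J7's `NE`).   §4 `quadraticChar_mul_mul_self_mul`, **`card_sub_one_mul_natCard_params_quadraticChar_eq_card_filter`** (J7's `NP`, `NM`).

## References
* [Rogawski1990] J. D. Rogawski, *Automorphic Representations of Unitary Groups in Three Variables*, Ann. of Math. Stud. 123 (1990), §4.9 Prop. 4.9.1 (b) p. 55.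
* [BruhatTits1972] F. Bruhat, J. Tits, *Groupes réductifs sur un corps local I*, Publ. Math. IHÉS 41 (1972), §10 (the star of a vertex = the residual conic).
* [IrelandRosen1990] K. Ireland, M. Rosen, *A Classical Introduction to Modern Number Theory*, GTM 84, Ch. 8 §1–§2 (counting solutions with the quadratic character).
-/

set_option autoImplicit false

namespace Literature.NumberTheory.Rogawski1990

open Finset Matrix
open Literature.NumberTheory.Automorphic Literature.NumberTheory.Automorphic.HermitianLattice Literature.NumberTheory.Automorphic.UnitaryGroup
open Literature.GroupTheory.SpecificGroups

variable {k : Type*} [Field k]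

/-! ## §1 Frame transport of predicate-cut isotropic vector counts along `y ↦ B·y` -/

/-- `ᵗ(By) M z' = ᵗy (ᵗB M) z'`: moving the frame across the pairing. [cite: BruhatTits1972, §10] -/
theorem dotProduct_frame_mulVec (B M : Matrix (Fin 3) (Fin 3) k) (y z : Fin 3 → k) :
    (B *ᵥ y) ⬝ᵥ (M *ᵥ z) = y ⬝ᵥ ((Bᵀ * M) *ᵥ z) := by
  rw [← Matrix.vecMul_transpose, ← Matrix.dotProduct_mulVec, Matrix.mulVec_mulVec]

/-- **The frame relation moves the form**: if `ᵗB J₀ B = c·diag(δ)` then `ᵗ(By) J₀ (Bz) = c·ᵗy diag(δ) z`. [cite: BruhatTits1972, §10] -/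
theorem dotProduct_frame_form_mulVec (B : Matrix (Fin 3) (Fin 3) k) {c : k} {δ : Fin 3 → k}
    (hframe : Bᵀ * ((StdForm.antidiagonal 3).over k) * B = c • Matrix.diagonal δ) (y z : Fin 3 → k) :
    (B *ᵥ y) ⬝ᵥ (((StdForm.antidiagonal 3).over k) *ᵥ (B *ᵥ z)) = c * (y ⬝ᵥ (Matrix.diagonal δ *ᵥ z)) := by
  rw [dotProduct_frame_mulVec, Matrix.mulVec_mulVec, hframe, Matrix.smul_mulVec, dotProduct_smul, smul_eq_mul]

/-- **The frame relation moves the leading form**: with `Ȳ = B·diag(s)·B⁻¹`, `ᵗ(By)(J₀Ȳ)(By) = c·Σ δᵢsᵢyᵢ²` (as `ᵗy diag(δ·s) y`). [cite: Rogawski1990, §4.9 p. 54] [cite: BruhatTits1972, §10] -/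
theorem dotProduct_frame_conj_mulVec (B : GL (Fin 3) k) {c : k} {δ : Fin 3 → k}
    (hframe : (B : Matrix (Fin 3) (Fin 3) k)ᵀ * ((StdForm.antidiagonal 3).over k) * (B : Matrix (Fin 3) (Fin 3) k) = c • Matrix.diagonal δ) (s : Fin 3 → k) (y : Fin 3 → k) :
    ((B : Matrix (Fin 3) (Fin 3) k) *ᵥ y) ⬝ᵥ ((((StdForm.antidiagonal 3).over k) * ((B : Matrix (Fin 3) (Fin 3) k) * Matrix.diagonal s * ((B⁻¹ : GL (Fin 3) k) : Matrix (Fin 3) (Fin 3) k))) *ᵥ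
        ((B : Matrix (Fin 3) (Fin 3) k) *ᵥ y)) = c * (y ⬝ᵥ (Matrix.diagonal (fun i => δ i * s i) *ᵥ y)) := by
  have hcancel : ((B : Matrix (Fin 3) (Fin 3) k) * Matrix.diagonal s * ((B⁻¹ : GL (Fin 3) k) : Matrix (Fin 3) (Fin 3) k)) *ᵥ ((B : Matrix (Fin 3) (Fin 3) k) *ᵥ y) =
      (B : Matrix (Fin 3) (Fin 3) k) *ᵥ (Matrix.diagonal s *ᵥ y) := by
    rw [Matrix.mulVec_mulVec, Matrix.mul_assoc, Matrix.mul_assoc, ← Units.val_mul, inv_mul_cancel, Units.val_one, Matrix.mul_one, ← Matrix.mulVec_mulVec]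
  rw [← Matrix.mulVec_mulVec, hcancel, dotProduct_frame_form_mulVec _ hframe, Matrix.mulVec_mulVec, Matrix.diagonal_mul_diagonal]

/-- `y ↦ B·y` is injective for `B ∈ GL₃`. [cite: BruhatTits1972, §10] -/
theorem mulVec_injective_of_GL (B : GL (Fin 3) k) : Function.Injective fun y : Fin 3 → k => (B : Matrix (Fin 3) (Fin 3) k) *ᵥ y := by
  intro y y' h
  have h' := congrArg (fun z => ((B⁻¹ : GL (Fin 3) k) : Matrix (Fin 3) (Fin 3) k) *ᵥ z) h
  simpa only [Matrix.mulVec_mulVec, ← Units.val_mul, inv_mul_cancel, Units.val_one, Matrix.one_mulVec] using h'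

/-- **FRAME TRANSPORT OF A PREDICATE-CUT ISOTROPIC VECTOR SET.**  With `ᵗB J₀ B = c·diag(δ)`, `c ≠ 0`, `Ȳ = B diag(s) B⁻¹` and ANY predicate `P` on values, the non-zero `J₀`-isotropic
`x` with `P(ᵗx(J₀Ȳ)x)` are exactly the `B`-images of the non-zero `diag(δ)`-isotropic `y` with `P(c·ᵗy diag(δs) y)`. [cite: Rogawski1990, §4.9 p. 54] [cite: BruhatTits1972, §10] -/
theorem image_frame_isotropic_pred_eq (B : GL (Fin 3) k) {c : k} (hc : c ≠ 0) {δ : Fin 3 → k}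
    (hframe : (B : Matrix (Fin 3) (Fin 3) k)ᵀ * ((StdForm.antidiagonal 3).over k) * (B : Matrix (Fin 3) (Fin 3) k) = c • Matrix.diagonal δ) (s : Fin 3 → k) (P : k → Prop) :
    (fun y : Fin 3 → k => (B : Matrix (Fin 3) (Fin 3) k) *ᵥ y) ''
        {y : Fin 3 → k | y ≠ 0 ∧ y ⬝ᵥ (Matrix.diagonal δ *ᵥ y) = 0 ∧ P (c * (y ⬝ᵥ (Matrix.diagonal (fun i => δ i * s i) *ᵥ y)))} =
      {x : Fin 3 → k | x ≠ 0 ∧ x ⬝ᵥ (((StdForm.antidiagonal 3).over k) *ᵥ x) = 0 ∧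
        P (x ⬝ᵥ ((((StdForm.antidiagonal 3).over k) * ((B : Matrix (Fin 3) (Fin 3) k) * Matrix.diagonal s * ((B⁻¹ : GL (Fin 3) k) : Matrix (Fin 3) (Fin 3) k))) *ᵥ x))} := by
  have hinv' : ∀ x : Fin 3 → k, (B : Matrix (Fin 3) (Fin 3) k) *ᵥ (((B⁻¹ : GL (Fin 3) k) : Matrix (Fin 3) (Fin 3) k) *ᵥ x) = x := fun x => by
    rw [Matrix.mulVec_mulVec, ← Units.val_mul, mul_inv_cancel, Units.val_one, Matrix.one_mulVec]
  ext x
  simp only [Set.mem_image, Set.mem_setOf_eq]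
  constructor
  · rintro ⟨y, ⟨hy0, hiso, hP⟩, rfl⟩
    refine ⟨fun h0 => hy0 (mulVec_injective_of_GL B (by simpa using h0)), ?_, ?_⟩
    · rw [dotProduct_frame_form_mulVec _ hframe, hiso, mul_zero]
    · rw [dotProduct_frame_conj_mulVec B hframe]
      exact hP
  · rintro ⟨hx0, hiso, hP⟩
    refine ⟨((B⁻¹ : GL (Fin 3) k) : Matrix (Fin 3) (Fin 3) k) *ᵥ x, ⟨?_, ?_, ?_⟩, hinv' x⟩
    · intro h0
      apply hx0
      rw [← hinv' x, h0, Matrix.mulVec_zero]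
    · have h := dotProduct_frame_form_mulVec (B : Matrix (Fin 3) (Fin 3) k) hframe (((B⁻¹ : GL (Fin 3) k) : Matrix (Fin 3) (Fin 3) k) *ᵥ x)
        (((B⁻¹ : GL (Fin 3) k) : Matrix (Fin 3) (Fin 3) k) *ᵥ x)
      rw [hinv' x, hiso] at h
      rcases mul_eq_zero.1 h.symm with h1 | h1
      · exact absurd h1 hc
      · exact h1
    · have h := dotProduct_frame_conj_mulVec B hframe s (((B⁻¹ : GL (Fin 3) k) : Matrix (Fin 3) (Fin 3) k) *ᵥ x)
      rw [hinv' x] at h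
      rw [← h]
      exact hP

/-- **The two predicate-cut isotropic vector counts agree** (`J₀`-model with `Ȳ = B diag(s) B⁻¹` vs diagonal model). [cite: Rogawski1990, §4.9 p. 54] [cite: BruhatTits1972, §10] -/
theorem ncard_isotropic_pred_eq_of_frame (B : GL (Fin 3) k) {c : k} (hc : c ≠ 0) {δ : Fin 3 → k}
    (hframe : (B : Matrix (Fin 3) (Fin 3) k)ᵀ * ((StdForm.antidiagonal 3).over k) * (B : Matrix (Fin 3) (Fin 3) k) = c • Matrix.diagonal δ) (s : Fin 3 → k) (P : k → Prop) :
    {x : Fin 3 → k | x ≠ 0 ∧ x ⬝ᵥ (((StdForm.antidiagonal 3).over k) *ᵥ x) = 0 ∧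
        P (x ⬝ᵥ ((((StdForm.antidiagonal 3).over k) * ((B : Matrix (Fin 3) (Fin 3) k) * Matrix.diagonal s * ((B⁻¹ : GL (Fin 3) k) : Matrix (Fin 3) (Fin 3) k))) *ᵥ x))}.ncard =
      {y : Fin 3 → k | y ≠ 0 ∧ y ⬝ᵥ (Matrix.diagonal δ *ᵥ y) = 0 ∧ P (c * (y ⬝ᵥ (Matrix.diagonal (fun i => δ i * s i) *ᵥ y)))}.ncard := by
  rw [← image_frame_isotropic_pred_eq B hc hframe s P, Set.ncard_image_of_injective _ (mulVec_injective_of_GL B)]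

/-! ## §2 Coordinates: `Fin 3 → k` versus `k × k × k`, and the zero vector -/

/-- `ᵗy diag(δ) y = δ₀y₀² + δ₁y₁² + δ₂y₂²`. [cite: IrelandRosen1990, Ch. 8 §2] -/
theorem dotProduct_diagonal_mulVec_three (δ y : Fin 3 → k) : y ⬝ᵥ (Matrix.diagonal δ *ᵥ y) = δ 0 * y 0 ^ 2 + δ 1 * y 1 ^ 2 + δ 2 * y 2 ^ 2 := by
  simp [dotProduct, Matrix.mulVec_diagonal, Fin.sum_univ_three]
  ring

omit [Field k] in
/-- **Coordinate dictionary**: `#{y : Fin 3 → k | p(y₀,y₁,y₂)} = #(filter over k × k × k)`. [cite: IrelandRosen1990, Ch. 8 §2] -/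
theorem ncard_setOf_fin_three_eq_card_filter [Fintype k] (p : k → k → k → Prop) [DecidablePred fun v : k × k × k => p v.1 v.2.1 v.2.2] :
    {y : Fin 3 → k | p (y 0) (y 1) (y 2)}.ncard = (univ.filter fun v : k × k × k => p v.1 v.2.1 v.2.2).card := by
  have himage : (fun y : Fin 3 → k => (y 0, y 1, y 2)) '' {y : Fin 3 → k | p (y 0) (y 1) (y 2)} = ↑(univ.filter fun v : k × k × k => p v.1 v.2.1 v.2.2) := by
    ext v
    simp only [Set.mem_image, Set.mem_setOf_eq, coe_filter, mem_univ, true_and]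
    constructor
    · rintro ⟨y, hy, rfl⟩
      exact hy
    · intro hv
      exact ⟨![v.1, v.2.1, v.2.2], by simpa using hv, by simp⟩
  rw [← Set.ncard_coe_finset, ← himage, Set.ncard_image_of_injective]
  intro y y' h
  simp only [Prod.mk.injEq] at h
  ext i
  fin_cases i
  · exact h.1
  · exact h.2.1
  · exact h.2.2

/-- Zero-vector bookkeeping: if `A 0` holds then `#{y ≠ 0 | A y} = #{y | A y} − 1` (finite ambient type). [cite: IrelandRosen1990, Ch. 8 §2] -/
theorem ncard_setOf_ne_zero_and_eq_ncard_sub_one [Finite k] (A : (Fin 3 → k) → Prop) (h0 : A 0) :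
    {y : Fin 3 → k | y ≠ 0 ∧ A y}.ncard = {y : Fin 3 → k | A y}.ncard - 1 := by
  have hset : {y : Fin 3 → k | A y} = insert 0 {y : Fin 3 → k | y ≠ 0 ∧ A y} := by
    ext y
    simp only [Set.mem_setOf_eq, Set.mem_insert_iff]
    constructor
    · intro hy
      by_cases h : y = 0
      · exact Or.inl h
      · exact Or.inr ⟨h, hy⟩
    · rintro (rfl | ⟨-, hy⟩)
      · exact h0
      · exact hy
  rw [hset, Set.ncard_insert_of_notMem (by simp) (Set.toFinite _), Nat.add_sub_cancel]

/-! ## §3 The NULL count: `J₀`-side null parameters = ★ RootTwists' chart set -/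

/-- **ROW-ROOT-CNT, NULL HALF (the engine's `NE ∕ q`).**  With `ᵗB J₀ B = c·diag(δ)` (`c ≠ 0`), `Ȳ = B·diag(s)·B⁻¹`, `s₁ = 0`, `δ₁, δ₂, s₂ ≠ 0`, `char k ≠ 2`:
the number of `Q_Ȳ`-null normalised isotropic parameters of the `J₀`-conic equals the number of points of ★ RootTwists' chart set
`{(a,b) : δ₀ + δ₁a² + δ₂b² = 0 ∧ δ₀s₀ + δ₂s₂b² = 0}` — hence `= (χ(δ₀δ₁s₂(s₀−s₂))+1)(χ(−δ₀δ₂s₀s₂)+1)` by ★ `card_rootNull`.  (★ G3″ → vectors; §1 → diagonal model; ★ `card_isoNull_eq`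
→ chart; cancel `q − 1`.) [cite: Rogawski1990, §4.9 Prop. 4.9.1 (b) p. 55] [cite: BruhatTits1972, §10] [cite: IrelandRosen1990, Ch. 8 §2] -/
theorem natCard_nullParams_conj_frame_eq_card_filter [Fintype k] [DecidableEq k] (hk : ringChar k ≠ 2) (B : GL (Fin 3) k) {c : k} (hc : c ≠ 0)
    {δ : Fin 3 → k} (hframe : (B : Matrix (Fin 3) (Fin 3) k)ᵀ * ((StdForm.antidiagonal 3).over k) * (B : Matrix (Fin 3) (Fin 3) k) = c • Matrix.diagonal δ)
    (hδ₁ : δ 1 ≠ 0) (hδ₂ : δ 2 ≠ 0) {s : Fin 3 → k} (hs₁ : s 1 = 0) (hs₂ : s 2 ≠ 0) :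
    Nat.card {p : Option {p : k × k // p.2 + (RingHom.id k) p.2 + p.1 * (RingHom.id k) p.1 = 0} //
        (p.elim (Pi.single 2 1) fun q => ![(1 : k), q.1.1, q.1.2]) ⬝ᵥ
          ((((StdForm.antidiagonal 3).over k) * ((B : Matrix (Fin 3) (Fin 3) k) * Matrix.diagonal s * ((B⁻¹ : GL (Fin 3) k) : Matrix (Fin 3) (Fin 3) k))) *ᵥ
            (p.elim (Pi.single 2 1) fun q => ![(1 : k), q.1.1, q.1.2])) = 0} =
      (univ.filter fun q : k × k => δ 0 + δ 1 * q.1 ^ 2 + δ 2 * q.2 ^ 2 = 0 ∧ δ 0 * s 0 + δ 2 * s 2 * q.2 ^ 2 = 0).card := by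
  -- (q − 1) · LHS = the `J₀`-side null vector count (★ G3″)
  have hvec := card_sub_one_mul_natCard_nullParams_eq_ncard (K := k)
    ((B : Matrix (Fin 3) (Fin 3) k) * Matrix.diagonal s * ((B⁻¹ : GL (Fin 3) k) : Matrix (Fin 3) (Fin 3) k))
  -- = the diagonal-side null vector count (§1 with `P := (· = 0)`, `c ≠ 0`)
  have hP := ncard_isotropic_pred_eq_of_frame B hc hframe s (fun t => t = 0)
  have hD : {y : Fin 3 → k | y ≠ 0 ∧ y ⬝ᵥ (Matrix.diagonal δ *ᵥ y) = 0 ∧ c * (y ⬝ᵥ (Matrix.diagonal (fun i => δ i * s i) *ᵥ y)) = 0} =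
      {y : Fin 3 → k | y ≠ 0 ∧ (δ 0 * y 0 ^ 2 + δ 1 * y 1 ^ 2 + δ 2 * y 2 ^ 2 = 0 ∧ δ 0 * s 0 * y 0 ^ 2 + δ 2 * s 2 * y 2 ^ 2 = 0)} := by
    ext y
    simp only [Set.mem_setOf_eq, dotProduct_diagonal_mulVec_three, mul_eq_zero, hc, false_or, hs₁, mul_zero, zero_mul, add_zero]
  -- the diagonal-side count with the zero vector added back is ★ `card_isoNull_eq`'s filter
  have hall : {y : Fin 3 → k | δ 0 * y 0 ^ 2 + δ 1 * y 1 ^ 2 + δ 2 * y 2 ^ 2 = 0 ∧ δ 0 * s 0 * y 0 ^ 2 + δ 2 * s 2 * y 2 ^ 2 = 0}.ncard =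
      (univ.filter fun v : k × k × k => δ 0 * v.1 ^ 2 + δ 1 * v.2.1 ^ 2 + δ 2 * v.2.2 ^ 2 = 0 ∧ δ 0 * s 0 * v.1 ^ 2 + δ 2 * s 2 * v.2.2 ^ 2 = 0).card :=
    ncard_setOf_fin_three_eq_card_filter (fun a b e => δ 0 * a ^ 2 + δ 1 * b ^ 2 + δ 2 * e ^ 2 = 0 ∧ δ 0 * s 0 * a ^ 2 + δ 2 * s 2 * e ^ 2 = 0)
  have hzero := ncard_setOf_ne_zero_and_eq_ncard_sub_one (k := k)
    (fun y => δ 0 * y 0 ^ 2 + δ 1 * y 1 ^ 2 + δ 2 * y 2 ^ 2 = 0 ∧ δ 0 * s 0 * y 0 ^ 2 + δ 2 * s 2 * y 2 ^ 2 = 0) (by simp)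
  have hchart := card_isoNull_eq (k := k) (d₀ := δ 0) (d₁ := δ 1) (d₂ := δ 2) (A := s 0) (C := s 2) hk hδ₁ hδ₂ hs₂
  -- assemble in ℕ: (q − 1) · LHS = (q − 1) · #chart
  have hq : 1 < Nat.card k := by
    rw [Nat.card_eq_fintype_card]
    exact Fintype.one_lt_card
  have hmain : (Nat.card k - 1) * Nat.card {p : Option {p : k × k // p.2 + (RingHom.id k) p.2 + p.1 * (RingHom.id k) p.1 = 0} //
        (p.elim (Pi.single 2 1) fun q => ![(1 : k), q.1.1, q.1.2]) ⬝ᵥ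
          ((((StdForm.antidiagonal 3).over k) * ((B : Matrix (Fin 3) (Fin 3) k) * Matrix.diagonal s * ((B⁻¹ : GL (Fin 3) k) : Matrix (Fin 3) (Fin 3) k))) *ᵥ
            (p.elim (Pi.single 2 1) fun q => ![(1 : k), q.1.1, q.1.2])) = 0} =
      (Nat.card k - 1) * (univ.filter fun q : k × k => δ 0 + δ 1 * q.1 ^ 2 + δ 2 * q.2 ^ 2 = 0 ∧ δ 0 * s 0 + δ 2 * s 2 * q.2 ^ 2 = 0).card := by
    rw [hvec, hP, hD, hzero, hall]
    have hint : (((univ.filter fun v : k × k × k => δ 0 * v.1 ^ 2 + δ 1 * v.2.1 ^ 2 + δ 2 * v.2.2 ^ 2 = 0 ∧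
        δ 0 * s 0 * v.1 ^ 2 + δ 2 * s 2 * v.2.2 ^ 2 = 0).card : ℕ) : ℤ) =
        1 + ((Nat.card k : ℤ) - 1) * ((univ.filter fun q : k × k => δ 0 + δ 1 * q.1 ^ 2 + δ 2 * q.2 ^ 2 = 0 ∧ δ 0 * s 0 + δ 2 * s 2 * q.2 ^ 2 = 0).card : ℤ) := by
      rw [hchart, Nat.card_eq_fintype_card]
    have hcast : (((1 + (Nat.card k - 1) * (univ.filter fun q : k × k => δ 0 + δ 1 * q.1 ^ 2 + δ 2 * q.2 ^ 2 = 0 ∧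
        δ 0 * s 0 + δ 2 * s 2 * q.2 ^ 2 = 0).card : ℕ)) : ℤ) =
        1 + ((Nat.card k : ℤ) - 1) * ((univ.filter fun q : k × k => δ 0 + δ 1 * q.1 ^ 2 + δ 2 * q.2 ^ 2 = 0 ∧ δ 0 * s 0 + δ 2 * s 2 * q.2 ^ 2 = 0).card : ℤ) := by
      push_cast [Nat.cast_sub hq.le]
      ring
    have hnat : ((univ.filter fun v : k × k × k => δ 0 * v.1 ^ 2 + δ 1 * v.2.1 ^ 2 + δ 2 * v.2.2 ^ 2 = 0 ∧
        δ 0 * s 0 * v.1 ^ 2 + δ 2 * s 2 * v.2.2 ^ 2 = 0).card : ℕ) =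
        1 + (Nat.card k - 1) * (univ.filter fun q : k × k => δ 0 + δ 1 * q.1 ^ 2 + δ 2 * q.2 ^ 2 = 0 ∧ δ 0 * s 0 + δ 2 * s 2 * q.2 ^ 2 = 0).card :=
      Nat.cast_inj.1 (hint.trans hcast.symm)
    omega
  exact Nat.eq_of_mul_eq_mul_left (by omega) hmain

/-! ## §4 The CLASS counts: `J₀`-side class parameters in ★ RootClassSplit's vector currency -/

/-- `χ(c₀·(e·e·t)) = χ(c₀·t)` for `e ≠ 0`: the class predicate `t ↦ χ(c₀t) = σ` is invariant under non-zero squares. [cite: IrelandRosen1990, Ch. 8 §1] -/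
theorem quadraticChar_mul_mul_self_mul [Fintype k] [DecidableEq k] (c₀ : k) {e : k} (he : e ≠ 0) (t : k) :
    quadraticChar k (c₀ * (e * e * t)) = quadraticChar k (c₀ * t) := by
  rw [show c₀ * (e * e * t) = e ^ 2 * (c₀ * t) by ring, map_mul, quadraticChar_sq_one' he, one_mul]

/-- **ROW-ROOT-CNT, CLASS HALF (the engine's `NP ∕ q`, `NM ∕ q`).**  With `ᵗB J₀ B = c·diag(δ)` (`c ≠ 0`), `Ȳ = B·diag(s)·B⁻¹`, `s₁ = 0`, `c₀ : k`, `σ : ℤ`: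
`(q − 1)·Nat.card {p // χ(c₀·ᵗx̄_p(J₀Ȳ)x̄_p) = σ} = #{v ∈ k³ : δ₀v₀² + δ₁v₁² + δ₂v₂² = 0 ∧ χ((c₀c)·(δ₀s₀v₀² + δ₂s₂v₂²)) = σ}` for `σ = ±1` — ★ RootClassSplit's
`two_mul_card_rootClass_eq` filter (`c := c₀c`, `A := s₀`, `C := s₂`); the zero vector is excluded on both sides since `χ(0) = 0 ≠ ±1`. [cite: Rogawski1990, §4.9 Prop. 4.9.1 (b) p. 55]
[cite: IrelandRosen1990, Ch. 8 §2] -/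
theorem card_sub_one_mul_natCard_params_quadraticChar_eq_card_filter [Fintype k] [DecidableEq k] (B : GL (Fin 3) k) {c : k} (hc : c ≠ 0)
    {δ : Fin 3 → k} (hframe : (B : Matrix (Fin 3) (Fin 3) k)ᵀ * ((StdForm.antidiagonal 3).over k) * (B : Matrix (Fin 3) (Fin 3) k) = c • Matrix.diagonal δ)
    {s : Fin 3 → k} (hs₁ : s 1 = 0) (c₀ : k) {σ : ℤ} (hσ : σ = 1 ∨ σ = -1) :
    (Nat.card k - 1) * Nat.card {p : Option {p : k × k // p.2 + (RingHom.id k) p.2 + p.1 * (RingHom.id k) p.1 = 0} //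
        quadraticChar k (c₀ * ((p.elim (Pi.single 2 1) fun q => ![(1 : k), q.1.1, q.1.2]) ⬝ᵥ
          ((((StdForm.antidiagonal 3).over k) * ((B : Matrix (Fin 3) (Fin 3) k) * Matrix.diagonal s * ((B⁻¹ : GL (Fin 3) k) : Matrix (Fin 3) (Fin 3) k))) *ᵥ
            (p.elim (Pi.single 2 1) fun q => ![(1 : k), q.1.1, q.1.2])))) = σ} =
      (univ.filter fun v : k × k × k => δ 0 * v.1 ^ 2 + δ 1 * v.2.1 ^ 2 + δ 2 * v.2.2 ^ 2 = 0 ∧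
        quadraticChar k ((c₀ * c) * (δ 0 * s 0 * v.1 ^ 2 + δ 2 * s 2 * v.2.2 ^ 2)) = σ).card := by
  have hσ0 : σ ≠ 0 := by rcases hσ with rfl | rfl <;> decide
  -- (q − 1) · LHS = the `J₀`-side class vector count (★ G3‴ with the square-invariant predicate `t ↦ χ(c₀t) = σ`)
  have hvec := card_sub_one_mul_natCard_params_eq_ncard (K := k)
    ((B : Matrix (Fin 3) (Fin 3) k) * Matrix.diagonal s * ((B⁻¹ : GL (Fin 3) k) : Matrix (Fin 3) (Fin 3) k)) (fun t => quadraticChar k (c₀ * t) = σ)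
    (fun e t he => by rw [quadraticChar_mul_mul_self_mul c₀ he t])
  have hP := ncard_isotropic_pred_eq_of_frame B hc hframe s (fun t => quadraticChar k (c₀ * t) = σ)
  have hD : {y : Fin 3 → k | y ≠ 0 ∧ y ⬝ᵥ (Matrix.diagonal δ *ᵥ y) = 0 ∧ quadraticChar k (c₀ * (c * (y ⬝ᵥ (Matrix.diagonal (fun i => δ i * s i) *ᵥ y)))) = σ} =
      {y : Fin 3 → k | δ 0 * y 0 ^ 2 + δ 1 * y 1 ^ 2 + δ 2 * y 2 ^ 2 = 0 ∧ quadraticChar k ((c₀ * c) * (δ 0 * s 0 * y 0 ^ 2 + δ 2 * s 2 * y 2 ^ 2)) = σ} := by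
    ext y
    simp only [Set.mem_setOf_eq, dotProduct_diagonal_mulVec_three, hs₁, mul_zero, zero_mul, add_zero]
    constructor
    · rintro ⟨-, h1, h2⟩
      refine ⟨h1, ?_⟩
      rw [← h2]; congr 1; ring
    · rintro ⟨h1, h2⟩
      refine ⟨?_, h1, ?_⟩
      · rintro rfl
        apply hσ0
        rw [← h2]
        simp
      · rw [← h2]; congr 1; ring
  rw [hvec, hP, hD]
  exact ncard_setOf_fin_three_eq_card_filter
    (fun a b e => δ 0 * a ^ 2 + δ 1 * b ^ 2 + δ 2 * e ^ 2 = 0 ∧ quadraticChar k ((c₀ * c) * (δ 0 * s 0 * a ^ 2 + δ 2 * s 2 * e ^ 2)) = σ)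

end Literature.NumberTheory.Rogawski1990
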